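import Mathlib.MeasureTheory.Integral.Pi
import Mathlib.Analysis.SpecialFunctions.Gaussian.GaussianIntegral
import Literature.Analysis.FluidPDE.GaussianVortexPlanarLinear

/-!
# The anisotropic Gaussian `𝒢_λ` solves the linear asymmetric Burgers problem (Gallay–Maekawa (4.4))

Companion of `Literature.Analysis.FluidPDE.GaussianVortexPlanar` (named fact
`GallayMaekawa2016_thm41`, work unit `provefact GallayMaekawa2016_thm41`). Gallay–Maekawa 2016,
(4.4) (PDF p. 15): the function
`𝒢_λ(x) = √(1−λ²)/(4π) · exp(−(1+λ)x₁²/4 − (1−λ)x₂²/4)` "solves the equation `L_λ𝒢_λ = 0` in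
`ℝ²` with `∫𝒢_λ = 1`", where `L_λ = Δ + (1+λ)/2 x₁∂₁ + (1−λ)/2 x₂∂₂ + 1` ((4.3),
`strainedVorticityOperator`). We PROVE (`gallayMaekawa2016_linearVortex`): for `λ ∈ [0,1)` and
every `α`, `f = α𝒢_λ` is smooth, integrable with `∫ f = α`, belongs to `L²(∞;λ)`
(`MemL2InftyLam`; indeed `f²/G_λ ∝ exp(−(1+3λ)x₁²/4 − (1−λ)x₂²/4)`), and solves `L_λ f = 0` in the
sense of distributions — i.e. the LINEAR part (drop the transport term `(v,∇)ω`) of the problem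
(4.2) whose nonlinear solvability is `GallayMaekawa2016_thm41`; `α𝒢_λ` is the profile around which
the asymmetric Burgers vortex is constructed for small `α` (Gallay–Wayne, [GW2] of the survey).

Also the CLASSICAL pointwise identity `L_λ(k e^{−q}) = 0` for the vendored
`strainedVorticityOperator` (`strainedVorticityOperator_gaussLam`, via `Δe^{−q}` in coordinates).

Ingredients: diagonal Gaussian integrals on `ℝ² = EuclideanSpace ℝ (Fin 2)` (transfer to
`Fin 2 → ℝ` by `EuclideanSpace.volume_preserving_symm_measurableEquiv_toLp`, then Fubini
`integral_fintype_prod_eq_prod` and `integral_gaussian`), the derivative of `𝒢_λ`, and the weak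
identity `integral_mul_adjointL_eq_zero` of `GaussianVortexPlanarLinear`.

## References

* Th. Gallay, Y. Maekawa, *Existence and stability of viscous vortices*, arXiv:1610.08384, §4.1,
  (4.3)–(4.6) (PDF p. 15). [GallayMaekawa2016]
-/

noncomputable section

open Set Function Filter MeasureTheory Metric WithLp
open scoped Laplacian InnerProductSpace RealInnerProductSpace ContDiff Topology

namespace Literature.Analysis.FluidPDE

/-! ### Diagonal Gaussian integrals on `ℝ²` -/

/-- Transfer of integrals from `EuclideanSpace ℝ (Fin 2)` to `Fin 2 → ℝ`. [folklore] -/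
theorem integral_comp_toLp_fin_two (g : EuclideanSpace ℝ (Fin 2) → ℝ) :
    ∫ v : Fin 2 → ℝ, g (toLp 2 v) = ∫ x, g x :=
  (PiLp.volume_preserving_toLp (Fin 2)).integral_comp
    (MeasurableEquiv.toLp 2 (Fin 2 → ℝ)).measurableEmbedding g

/-- Transfer of integrability from `EuclideanSpace ℝ (Fin 2)` to `Fin 2 → ℝ`. [folklore] -/
theorem integrable_comp_toLp_fin_two_iff (g : EuclideanSpace ℝ (Fin 2) → ℝ) :
    Integrable (fun v : Fin 2 → ℝ => g (toLp 2 v)) ↔ Integrable g :=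
  (PiLp.volume_preserving_toLp (Fin 2)).integrable_comp_emb
    (MeasurableEquiv.toLp 2 (Fin 2 → ℝ)).measurableEmbedding

/-- A diagonal Gaussian on `Fin 2 → ℝ` is a product of one-dimensional Gaussians. [folklore] -/
theorem exp_neg_quadratic_eq_prod (a b : ℝ) (v : Fin 2 → ℝ) :
    Real.exp (-(a * v 0 ^ 2 + b * v 1 ^ 2)) = ∏ i : Fin 2, Real.exp (-(![a, b] i) * v i ^ 2) := by
  rw [Fin.prod_univ_two, ← Real.exp_add]
  congr 1
  simp
  ring

/-- Diagonal Gaussians `exp(−(a x₀² + b x₁²))`, `a, b > 0`, are integrable on `ℝ²`. [folklore] -/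
theorem integrable_exp_neg_quadratic {a b : ℝ} (ha : 0 < a) (hb : 0 < b) :
    Integrable fun x : EuclideanSpace ℝ (Fin 2) => Real.exp (-(a * x 0 ^ 2 + b * x 1 ^ 2)) := by
  rw [← integrable_comp_toLp_fin_two_iff]
  simp_rw [exp_neg_quadratic_eq_prod]
  refine Integrable.fintype_prod (f := fun i t => Real.exp (-(![a, b] i) * t ^ 2)) fun i => ?_
  fin_cases i
  · simpa using integrable_exp_neg_mul_sq ha
  · simpa using integrable_exp_neg_mul_sq hb

/-- **Diagonal Gaussian integral on `ℝ²`**: `∫ exp(−(a x₀² + b x₁²)) dx = √(π/a) √(π/b)`.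
[folklore] -/
theorem integral_exp_neg_quadratic (a b : ℝ) :
    ∫ x : EuclideanSpace ℝ (Fin 2), Real.exp (-(a * x 0 ^ 2 + b * x 1 ^ 2)) =
      Real.sqrt (Real.pi / a) * Real.sqrt (Real.pi / b) := by
  rw [← integral_comp_toLp_fin_two]
  simp_rw [exp_neg_quadratic_eq_prod]
  have h := integral_fintype_prod_volume_eq_prod (ι := Fin 2) (𝕜 := ℝ) (E := fun _ : Fin 2 => ℝ)
    (fun (i : Fin 2) (t : ℝ) => Real.exp (-(![a, b] i) * t ^ 2))
  rw [h, Fin.prod_univ_two]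
  simp only [Matrix.cons_val_zero, Matrix.cons_val_one, Matrix.cons_val_fin_one]
  rw [integral_gaussian, integral_gaussian]

/-! ### The anisotropic Gaussian `𝒢_λ` -/

section GaussLam

variable (lam : ℝ)

/-- `∂₀` and `∂₁` of the quadratic form `q(x) = (1+λ)/4 x₀² + (1−λ)/4 x₁²`. [folklore] -/
theorem hasFDerivAt_quadraticLam (x : EuclideanSpace ℝ (Fin 2)) :
    HasFDerivAt
      (fun y : EuclideanSpace ℝ (Fin 2) => (1 + lam) / 4 * y 0 ^ 2 + (1 - lam) / 4 * y 1 ^ 2)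
      (((1 + lam) / 4 * (2 * x 0)) • (EuclideanSpace.proj 0 : EuclideanSpace ℝ (Fin 2) →L[ℝ] ℝ) +
        ((1 - lam) / 4 * (2 * x 1)) • (EuclideanSpace.proj 1 : EuclideanSpace ℝ (Fin 2) →L[ℝ] ℝ))
      x := by
  have h0 : HasFDerivAt (fun y : EuclideanSpace ℝ (Fin 2) => y 0)
      (EuclideanSpace.proj 0 : EuclideanSpace ℝ (Fin 2) →L[ℝ] ℝ) x :=
    (EuclideanSpace.proj (0 : Fin 2) : EuclideanSpace ℝ (Fin 2) →L[ℝ] ℝ).hasFDerivAt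
  have h1 : HasFDerivAt (fun y : EuclideanSpace ℝ (Fin 2) => y 1)
      (EuclideanSpace.proj 1 : EuclideanSpace ℝ (Fin 2) →L[ℝ] ℝ) x :=
    (EuclideanSpace.proj (1 : Fin 2) : EuclideanSpace ℝ (Fin 2) →L[ℝ] ℝ).hasFDerivAt
  have h0' := (h0.pow 2).const_mul ((1 + lam) / 4)
  have h1' := (h1.pow 2).const_mul ((1 - lam) / 4)
  refine (h0'.add h1').congr_fderiv ?_
  ext v
  simp
  ring

/-- The (unnormalised) anisotropic Gaussian `exp(−q)` and its derivative. [folklore] -/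
theorem hasFDerivAt_exp_neg_quadraticLam (x : EuclideanSpace ℝ (Fin 2)) :
    HasFDerivAt (fun y : EuclideanSpace ℝ (Fin 2) =>
        Real.exp (-((1 + lam) / 4 * y 0 ^ 2 + (1 - lam) / 4 * y 1 ^ 2)))
      (Real.exp (-((1 + lam) / 4 * x 0 ^ 2 + (1 - lam) / 4 * x 1 ^ 2)) •
        -(((1 + lam) / 4 * (2 * x 0)) •
            (EuclideanSpace.proj 0 : EuclideanSpace ℝ (Fin 2) →L[ℝ] ℝ) +
          ((1 - lam) / 4 * (2 * x 1)) •
            (EuclideanSpace.proj 1 : EuclideanSpace ℝ (Fin 2) →L[ℝ] ℝ))) x :=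
  (hasFDerivAt_quadraticLam lam x).neg.exp

/-- `∂₀ e^{−q} = −((1+λ)x₀/2) e^{−q}`. [folklore] -/
theorem fderiv_exp_neg_quadraticLam_zero (x : EuclideanSpace ℝ (Fin 2)) :
    fderiv ℝ (fun y : EuclideanSpace ℝ (Fin 2) =>
        Real.exp (-((1 + lam) / 4 * y 0 ^ 2 + (1 - lam) / 4 * y 1 ^ 2))) x
      (EuclideanSpace.single 0 (1 : ℝ)) =
      -((1 + lam) * x 0 / 2) *
        Real.exp (-((1 + lam) / 4 * x 0 ^ 2 + (1 - lam) / 4 * x 1 ^ 2)) := by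
  rw [(hasFDerivAt_exp_neg_quadraticLam lam x).fderiv]
  simp
  ring

/-- `∂₁ e^{−q} = −((1−λ)x₁/2) e^{−q}`. [folklore] -/
theorem fderiv_exp_neg_quadraticLam_one (x : EuclideanSpace ℝ (Fin 2)) :
    fderiv ℝ (fun y : EuclideanSpace ℝ (Fin 2) =>
        Real.exp (-((1 + lam) / 4 * y 0 ^ 2 + (1 - lam) / 4 * y 1 ^ 2))) x
      (EuclideanSpace.single 1 (1 : ℝ)) =
      -((1 - lam) * x 1 / 2) *
        Real.exp (-((1 + lam) / 4 * x 0 ^ 2 + (1 - lam) / 4 * x 1 ^ 2)) := by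
  rw [(hasFDerivAt_exp_neg_quadraticLam lam x).fderiv]
  simp
  ring

/-- `e^{−q}` is smooth. [folklore] -/
theorem contDiff_exp_neg_quadraticLam {n : WithTop ℕ∞} :
    ContDiff ℝ n fun y : EuclideanSpace ℝ (Fin 2) =>
      Real.exp (-((1 + lam) / 4 * y 0 ^ 2 + (1 - lam) / 4 * y 1 ^ 2)) :=
  Real.contDiff_exp.comp
    ((contDiff_const.mul
      ((EuclideanSpace.proj (0 : Fin 2) : EuclideanSpace ℝ (Fin 2) →L[ℝ] ℝ).contDiff.pow 2)).add
      (contDiff_const.mul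
      ((EuclideanSpace.proj (1 : Fin 2) : EuclideanSpace ℝ (Fin 2) →L[ℝ] ℝ).contDiff.pow 2))).neg

end GaussLam

/-- **Gallay–Maekawa 2016, (4.4): the anisotropic Gaussian `α𝒢_λ` solves the linear asymmetric
Burgers problem.** For `λ ∈ [0, 1)` and `α ∈ ℝ` the function
`f = α𝒢_λ`, `𝒢_λ(x) = √(1−λ²)/(4π) exp(−(1+λ)x₀²/4 − (1−λ)x₁²/4)`, is smooth and integrable with
`∫ f = α`, lies in `L²(∞;λ)` (4.6), and solves `L_λ f = 0` in the sense of distributions: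
`∫ f (Δφ − ((1+λ)/2 x₀∂₀φ + (1−λ)/2 x₁∂₁φ)) = 0` for every test function `φ` (the weak form used
in `IsWeakAsymBurgersVortex`, without the transport term). [cite: GallayMaekawa2016, (4.4)] -/
theorem gallayMaekawa2016_linearVortex (lam : ℝ) (hlam : lam ∈ Set.Ico (0 : ℝ) 1) (α : ℝ) :
    ∃ f : EuclideanSpace ℝ (Fin 2) → ℝ, ContDiff ℝ ∞ f ∧ Integrable f ∧ ∫ x, f x = α ∧
      MemL2InftyLam lam f ∧
      ∀ φ : EuclideanSpace ℝ (Fin 2) → ℝ, ContDiff ℝ ∞ φ → HasCompactSupport φ →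
        ∫ x, f x * (Δ φ x - ((1 + lam) / 2 * x 0 * fderiv ℝ φ x (EuclideanSpace.single 0 1) +
          (1 - lam) / 2 * x 1 * fderiv ℝ φ x (EuclideanSpace.single 1 1))) = 0 := by
  obtain ⟨h0, h1⟩ := hlam
  have hp : 0 < (1 + lam) / 4 := by linarith
  have hq : 0 < (1 - lam) / 4 := by linarith
  -- the unnormalised Gaussian `g = e^{−q}` and the normalisation `c = √(1−λ²)/(4π)`
  set g : EuclideanSpace ℝ (Fin 2) → ℝ := fun y =>
    Real.exp (-((1 + lam) / 4 * y 0 ^ 2 + (1 - lam) / 4 * y 1 ^ 2)) with hg_def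
  set c : ℝ := Real.sqrt (1 - lam ^ 2) / (4 * Real.pi) with hc_def
  have hgi : Integrable g := integrable_exp_neg_quadratic hp hq
  have hp' : (1 + lam) / 4 ≠ 0 := hp.ne'
  have hq' : (1 - lam) / 4 ≠ 0 := hq.ne'
  have hgint : ∫ x, g x =
      Real.sqrt (Real.pi / ((1 + lam) / 4)) * Real.sqrt (Real.pi / ((1 - lam) / 4)) :=
    integral_exp_neg_quadratic _ _
  have hcg : c * ∫ x, g x = 1 := by
    rw [hgint, hc_def]
    have h16 : 1 - lam ^ 2 = 16 * ((1 + lam) / 4) * ((1 - lam) / 4) := by ring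
    rw [h16, ← Real.sqrt_mul (show (0 : ℝ) ≤ Real.pi / ((1 + lam) / 4) by positivity),
      div_mul_eq_mul_div,
      ← Real.sqrt_mul (show (0 : ℝ) ≤ 16 * ((1 + lam) / 4) * ((1 - lam) / 4) by positivity),
      div_eq_one_iff_eq (by positivity)]
    rw [show 16 * ((1 + lam) / 4) * ((1 - lam) / 4) * (Real.pi / ((1 + lam) / 4) *
        (Real.pi / ((1 - lam) / 4))) = (4 * Real.pi) ^ 2 by field_simp; ring]
    exact Real.sqrt_sq (by positivity)
  refine ⟨fun x => α * (c * g x), ?_, (hgi.const_mul c).const_mul α, ?_, ?_, ?_⟩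
  · exact contDiff_const.mul (contDiff_const.mul (contDiff_exp_neg_quadraticLam lam))
  · rw [integral_const_mul, integral_const_mul, hcg, mul_one]
  · -- `f²/G_λ = (αc)² (4π/(1−λ)) exp(−((1+3λ)/4 x₀² + (1−λ)/4 x₁²))`
    refine ⟨(contDiff_const.mul (contDiff_const.mul
      (contDiff_exp_neg_quadraticLam lam (n := 0)))).continuous.aestronglyMeasurable, ?_⟩
    have ha : 0 < (1 + 3 * lam) / 4 := by linarith
    refine ((integrable_exp_neg_quadratic ha hq).const_mul
      ((α * c) ^ 2 * (4 * Real.pi / (1 - lam)))).congr (Eventually.of_forall fun x => ?_)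
    have hn : ‖x‖ ^ 2 = x 0 ^ 2 + x 1 ^ 2 := by
      rw [EuclideanSpace.norm_sq_eq]; simp [Fin.sum_univ_two]
    have hG : gaussWeightLam lam x = (1 - lam) / (4 * Real.pi) *
        Real.exp (-((1 - lam) / 4 * (x 0 ^ 2 + x 1 ^ 2))) := by
      rw [gaussWeightLam, hn]
    have hGpos : 0 < gaussWeightLam lam x := by rw [hG]; positivity
    have hl : (1 - lam) ≠ 0 := ne_of_gt (by linarith)
    simp only [hg_def]
    rw [eq_div_iff hGpos.ne', hG]
    have : Real.exp (-((1 + lam) / 4 * x 0 ^ 2 + (1 - lam) / 4 * x 1 ^ 2)) ^ 2 =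
        Real.exp (-((1 + 3 * lam) / 4 * x 0 ^ 2 + (1 - lam) / 4 * x 1 ^ 2)) *
          Real.exp (-((1 - lam) / 4 * (x 0 ^ 2 + x 1 ^ 2))) := by
      rw [sq, ← Real.exp_add, ← Real.exp_add]
      congr 1
      ring
    simp only [mul_pow]
    rw [this]
    field_simp
  · intro φ hφ hφc
    have hd : Differentiable ℝ fun x => α * (c * g x) :=
      ((contDiff_exp_neg_quadraticLam lam (n := 1)).differentiable (by simp)).const_mul c
        |>.const_mul α
    refine integral_mul_adjointL_eq_zero hφ hφc lam hd
      (contDiff_const.mul (contDiff_const.mul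
        (contDiff_exp_neg_quadraticLam lam (n := 0)))).continuous (fun x => ?_) (fun x => ?_)
    · have hdg : DifferentiableAt ℝ g x :=
        (contDiff_exp_neg_quadraticLam lam (n := 1)).differentiable (by simp) x
      rw [fderiv_const_mul (hdg.const_mul c), fderiv_const_mul hdg, FunLike.coe_smul,
        Pi.smul_apply, FunLike.coe_smul, Pi.smul_apply, smul_eq_mul, smul_eq_mul, hg_def,
        fderiv_exp_neg_quadraticLam_zero]
      ring
    · have hdg : DifferentiableAt ℝ g x :=
        (contDiff_exp_neg_quadraticLam lam (n := 1)).differentiable (by simp) x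
      rw [fderiv_const_mul (hdg.const_mul c), fderiv_const_mul hdg, FunLike.coe_smul,
        Pi.smul_apply, FunLike.coe_smul, Pi.smul_apply, smul_eq_mul, smul_eq_mul, hg_def,
        fderiv_exp_neg_quadraticLam_one]
      ring

/-! ### The classical identity `L_λ 𝒢_λ = 0` (Gallay–Maekawa (4.4), pointwise) -/

section Classical

variable (lam : ℝ)

/-- `∂₀∂₀ e^{−q} = (((1+λ)x₀/2)² − (1+λ)/2) e^{−q}`. [folklore] -/
theorem fderiv_fderiv_exp_neg_quadraticLam_zero (x : EuclideanSpace ℝ (Fin 2)) :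
    fderiv ℝ (fun y => fderiv ℝ (fun z : EuclideanSpace ℝ (Fin 2) =>
        Real.exp (-((1 + lam) / 4 * z 0 ^ 2 + (1 - lam) / 4 * z 1 ^ 2))) y
        (EuclideanSpace.single 0 (1 : ℝ))) x (EuclideanSpace.single 0 (1 : ℝ)) =
      (((1 + lam) * x 0 / 2) ^ 2 - (1 + lam) / 2) *
        Real.exp (-((1 + lam) / 4 * x 0 ^ 2 + (1 - lam) / 4 * x 1 ^ 2)) := by
  have hfun : (fun y => fderiv ℝ (fun z : EuclideanSpace ℝ (Fin 2) =>
      Real.exp (-((1 + lam) / 4 * z 0 ^ 2 + (1 - lam) / 4 * z 1 ^ 2))) y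
        (EuclideanSpace.single 0 (1 : ℝ))) = fun y : EuclideanSpace ℝ (Fin 2) =>
      (-(1 + lam) / 2 * y 0) * Real.exp (-((1 + lam) / 4 * y 0 ^ 2 + (1 - lam) / 4 * y 1 ^ 2)) := by
    funext y; rw [fderiv_exp_neg_quadraticLam_zero]; ring
  have hP : HasFDerivAt (fun y : EuclideanSpace ℝ (Fin 2) => -(1 + lam) / 2 * y 0)
      ((-(1 + lam) / 2) • (EuclideanSpace.proj 0 : EuclideanSpace ℝ (Fin 2) →L[ℝ] ℝ)) x :=
    (EuclideanSpace.proj (0 : Fin 2) : EuclideanSpace ℝ (Fin 2) →L[ℝ] ℝ).hasFDerivAt.const_mul _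
  have h2 := (hP.mul (hasFDerivAt_exp_neg_quadraticLam lam x)).fderiv
  simp only [Pi.mul_def] at h2
  rw [hfun, h2]
  simp
  ring

/-- `∂₁∂₁ e^{−q} = (((1−λ)x₁/2)² − (1−λ)/2) e^{−q}`. [folklore] -/
theorem fderiv_fderiv_exp_neg_quadraticLam_one (x : EuclideanSpace ℝ (Fin 2)) :
    fderiv ℝ (fun y => fderiv ℝ (fun z : EuclideanSpace ℝ (Fin 2) =>
        Real.exp (-((1 + lam) / 4 * z 0 ^ 2 + (1 - lam) / 4 * z 1 ^ 2))) y
        (EuclideanSpace.single 1 (1 : ℝ))) x (EuclideanSpace.single 1 (1 : ℝ)) =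
      (((1 - lam) * x 1 / 2) ^ 2 - (1 - lam) / 2) *
        Real.exp (-((1 + lam) / 4 * x 0 ^ 2 + (1 - lam) / 4 * x 1 ^ 2)) := by
  have hfun : (fun y => fderiv ℝ (fun z : EuclideanSpace ℝ (Fin 2) =>
      Real.exp (-((1 + lam) / 4 * z 0 ^ 2 + (1 - lam) / 4 * z 1 ^ 2))) y
        (EuclideanSpace.single 1 (1 : ℝ))) = fun y : EuclideanSpace ℝ (Fin 2) =>
      (-(1 - lam) / 2 * y 1) * Real.exp (-((1 + lam) / 4 * y 0 ^ 2 + (1 - lam) / 4 * y 1 ^ 2)) := by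
    funext y; rw [fderiv_exp_neg_quadraticLam_one]; ring
  have hP : HasFDerivAt (fun y : EuclideanSpace ℝ (Fin 2) => -(1 - lam) / 2 * y 1)
      ((-(1 - lam) / 2) • (EuclideanSpace.proj 1 : EuclideanSpace ℝ (Fin 2) →L[ℝ] ℝ)) x :=
    (EuclideanSpace.proj (1 : Fin 2) : EuclideanSpace ℝ (Fin 2) →L[ℝ] ℝ).hasFDerivAt.const_mul _
  have h2 := (hP.mul (hasFDerivAt_exp_neg_quadraticLam lam x)).fderiv
  simp only [Pi.mul_def] at h2
  rw [hfun, h2]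
  simp
  ring

/-- The Laplacian of the anisotropic Gaussian:
`Δ e^{−q} = (((1+λ)x₀/2)² + ((1−λ)x₁/2)² − 1) e^{−q}`. [folklore] -/
theorem laplacian_exp_neg_quadraticLam (x : EuclideanSpace ℝ (Fin 2)) :
    Δ (fun z : EuclideanSpace ℝ (Fin 2) =>
        Real.exp (-((1 + lam) / 4 * z 0 ^ 2 + (1 - lam) / 4 * z 1 ^ 2))) x =
      (((1 + lam) * x 0 / 2) ^ 2 + ((1 - lam) * x 1 / 2) ^ 2 - 1) *
        Real.exp (-((1 + lam) / 4 * x 0 ^ 2 + (1 - lam) / 4 * x 1 ^ 2)) := by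
  rw [laplacian_eq_fin_two (contDiff_exp_neg_quadraticLam lam),
    fderiv_fderiv_exp_neg_quadraticLam_zero, fderiv_fderiv_exp_neg_quadraticLam_one]
  ring

/-- **`L_λ 𝒢_λ = 0` pointwise** (Gallay–Maekawa 2016, (4.4): `𝒢_λ` "solves the equation
`L_λ𝒢_λ = 0` in `ℝ²`"), for every constant multiple `k e^{−(1+λ)x₀²/4 − (1−λ)x₁²/4}` of the
anisotropic Gaussian and the vendored operator `strainedVorticityOperator lam = L_λ` of (4.3).
[cite: GallayMaekawa2016, (4.4)] -/
theorem strainedVorticityOperator_gaussLam (k : ℝ) (x : EuclideanSpace ℝ (Fin 2)) :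
    strainedVorticityOperator lam (fun y : EuclideanSpace ℝ (Fin 2) =>
      k * Real.exp (-((1 + lam) / 4 * y 0 ^ 2 + (1 - lam) / 4 * y 1 ^ 2))) x = 0 := by
  have hc := contDiff_exp_neg_quadraticLam lam (n := 2)
  have hd : DifferentiableAt ℝ (fun y : EuclideanSpace ℝ (Fin 2) =>
      Real.exp (-((1 + lam) / 4 * y 0 ^ 2 + (1 - lam) / 4 * y 1 ^ 2))) x :=
    (contDiff_exp_neg_quadraticLam lam (n := 1)).differentiable (by simp) x
  have hΔ : Δ (fun y : EuclideanSpace ℝ (Fin 2) =>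
      k * Real.exp (-((1 + lam) / 4 * y 0 ^ 2 + (1 - lam) / 4 * y 1 ^ 2))) x =
      k * Δ (fun y : EuclideanSpace ℝ (Fin 2) =>
        Real.exp (-((1 + lam) / 4 * y 0 ^ 2 + (1 - lam) / 4 * y 1 ^ 2))) x := by
    have := InnerProductSpace.laplacian_smul k (hc.contDiffAt (x := x))
    simpa [Pi.smul_def, smul_eq_mul] using this
  rw [strainedVorticityOperator, hΔ, fderiv_const_mul hd, FunLike.coe_smul, Pi.smul_apply,
    Pi.smul_apply, smul_eq_mul, smul_eq_mul, fderiv_exp_neg_quadraticLam_zero,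
    fderiv_exp_neg_quadraticLam_one, laplacian_exp_neg_quadraticLam]
  ring

end Classical

end Literature.Analysis.FluidPDE
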